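import Mathlib.LinearAlgebra.Matrix.NonsingularInverse
import Mathlib.Data.Real.Basic
import Mathlib.Tactic.Linarith
import HarnessLib

/-!
# Structured modified Newton methods for the Lagrange system (Luenberger–Ye, held copy §14.4)

[LY08] = D. G. Luenberger, Y. Ye, *Linear and Nonlinear Programming* [LuenbergerYe2008], chapter
"Lagrange methods" (numbered 14 in the held copy `book:luenberger2008-linear-nonlinear-programming`,
15 in the Springer 2008 printing), section "Modified Newton methods" (§14.4): structured methods
(33)–(37) and multiplier update methods (38) with the updates (a)–(d).

Setting (32): `minimize f(x)` subject to `h(x) = 0`; at the current point `A = ∇h(x_k)` (`m × n`),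
`l = ∇l(x_k, λ_k)ᵀ = ∇f(x_k)ᵀ + Aᵀλ_k`, `hv = h(x_k)`, and `B` a (positive definite, here:
nonsingular) approximation of the Hessian of the Lagrangian. The structured step solves (34)
`Bd + Aᵀy = −l`, `Ad = −hv`.

* **(36)–(37)**: with `Q = AB⁻¹Aᵀ` nonsingular, the explicit solution
  `y = Q⁻¹[hv − AB⁻¹l]` (`newtonMultiplier`), `d = −B⁻¹[I − AᵀQ⁻¹AB⁻¹]l − B⁻¹AᵀQ⁻¹hv`
  (`newtonDir`); it satisfies (34) (`newtonDir_eq`, `structured_top`, `structured_bottom`) and is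
  the only solution (`structured_unique`).
* **(35)**: writing `l = ∇fᵀ + Aᵀλ_k`, the system is equivalently `Bd + Aᵀλ_{k+1} = −∇fᵀ`,
  `Ad = −hv` with `λ_{k+1} = λ_k + y` (`shifted_top_iff`).
* **(38) and update (d)**: `x_{k+1} = x_k − B⁻¹∇l(x_k, λ̂)ᵀ` with `λ̂ = Q⁻¹[hv − AB⁻¹∇fᵀ]` is the
  structured step ("the multiplier update method using this formula is therefore equivalent to the
  structured method") — `update_d_structured`; **update (c)** is the case `B = I`
  (`newtonMultiplier_one`).
* **Update (b)**, the least-squares multiplier `λ̂ = −(AAᵀ)⁻¹A∇fᵀ` (sign for the convention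
  `l = f + λᵀh`): `∇l(x, λ̂)ᵀ = ∇fᵀ + Aᵀλ̂` is the projection of `∇fᵀ` onto the tangent subspace
  `{Ad = 0}` (`lsMultiplier_tangent`, `lsMultiplier_grad_eq_proj`) and `λ̂` minimizes
  `|∇fᵀ + Aᵀλ|²` over `λ` (`lsMultiplier_isLeast`).

Published results only (Lean placement rule): every public declaration carries its
`[cite: LuenbergerYe2008, §14.4 …]` locator (held-copy numbering).
-/

namespace Literature.Analysis.Convex.StructuredNewtonLagrange

open Matrix

variable {m n : Type*} [Fintype m] [Fintype n] [DecidableEq m] [DecidableEq n]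

/-- (36): the multiplier part of the structured Newton step, `y = (AB⁻¹Aᵀ)⁻¹[hv − AB⁻¹l]`.
[cite: LuenbergerYe2008, §14.4 (36)] -/
noncomputable def newtonMultiplier (B : Matrix n n ℝ) (A : Matrix m n ℝ) (l : n → ℝ)
    (hv : m → ℝ) : m → ℝ :=
  (A * B⁻¹ * Aᵀ)⁻¹ *ᵥ (hv - A *ᵥ (B⁻¹ *ᵥ l))

/-- (37): the direction part of the structured Newton step,
`d = −B⁻¹[I − Aᵀ(AB⁻¹Aᵀ)⁻¹AB⁻¹]l − B⁻¹Aᵀ(AB⁻¹Aᵀ)⁻¹hv`. [cite: LuenbergerYe2008, §14.4 (37)] -/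
noncomputable def newtonDir (B : Matrix n n ℝ) (A : Matrix m n ℝ) (l : n → ℝ) (hv : m → ℝ) :
    n → ℝ :=
  -(B⁻¹ *ᵥ (l - Aᵀ *ᵥ ((A * B⁻¹ * Aᵀ)⁻¹ *ᵥ (A *ᵥ (B⁻¹ *ᵥ l))))) -
    B⁻¹ *ᵥ (Aᵀ *ᵥ ((A * B⁻¹ * Aᵀ)⁻¹ *ᵥ hv))

/-- (37) regrouped through (36): `d = −B⁻¹[l + Aᵀy]`. [cite: LuenbergerYe2008, §14.4 (36)-(37)] -/
theorem newtonDir_eq (B : Matrix n n ℝ) (A : Matrix m n ℝ) (l : n → ℝ) (hv : m → ℝ) :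
    newtonDir B A l hv = -(B⁻¹ *ᵥ (l + Aᵀ *ᵥ newtonMultiplier B A l hv)) := by
  unfold newtonDir newtonMultiplier
  rw [mulVec_sub, mulVec_sub, mulVec_add, mulVec_sub, mulVec_sub]
  abel

/-- The step satisfies the top block of (34): `Bd + Aᵀy = −l` (for `B` nonsingular).
[cite: LuenbergerYe2008, §14.4 (34), (36)-(37)] -/
theorem structured_top {B : Matrix n n ℝ} (hB : IsUnit B.det) (A : Matrix m n ℝ) (l : n → ℝ)
    (hv : m → ℝ) :
    B *ᵥ newtonDir B A l hv + Aᵀ *ᵥ newtonMultiplier B A l hv = -l := by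
  rw [newtonDir_eq, mulVec_neg, mulVec_mulVec, mul_nonsing_inv B hB, one_mulVec]
  abel

/-- The step satisfies the bottom block of (34): `Ad = −hv` (for `B` and `Q = AB⁻¹Aᵀ`
nonsingular). [cite: LuenbergerYe2008, §14.4 (34), (36)-(37)] -/
theorem structured_bottom {B : Matrix n n ℝ} {A : Matrix m n ℝ} (hQ : IsUnit (A * B⁻¹ * Aᵀ).det)
    (l : n → ℝ) (hv : m → ℝ) : A *ᵥ newtonDir B A l hv = -hv := by
  have e : A *ᵥ (B⁻¹ *ᵥ (Aᵀ *ᵥ newtonMultiplier B A l hv)) = hv - A *ᵥ (B⁻¹ *ᵥ l) := by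
    unfold newtonMultiplier
    rw [mulVec_mulVec, mulVec_mulVec, mulVec_mulVec, mul_nonsing_inv _ hQ, one_mulVec]
  rw [newtonDir_eq, mulVec_neg, mulVec_add, mulVec_add, e]
  abel

/-- Uniqueness: any solution `(d', y')` of (34) is the pair (36)–(37) (for `B` and `AB⁻¹Aᵀ`
nonsingular) — "we can write the explicit solution". [cite: LuenbergerYe2008, §14.4 (34)-(37)] -/
theorem structured_unique {B : Matrix n n ℝ} (hB : IsUnit B.det) {A : Matrix m n ℝ}
    (hQ : IsUnit (A * B⁻¹ * Aᵀ).det) {l d' : n → ℝ} {hv y' : m → ℝ}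
    (htop : B *ᵥ d' + Aᵀ *ᵥ y' = -l) (hbot : A *ᵥ d' = -hv) :
    y' = newtonMultiplier B A l hv ∧ d' = newtonDir B A l hv := by
  have hd' : d' = -(B⁻¹ *ᵥ (l + Aᵀ *ᵥ y')) := by
    have e : B⁻¹ *ᵥ (B *ᵥ d' + Aᵀ *ᵥ y') = B⁻¹ *ᵥ (-l) := by rw [htop]
    rw [mulVec_add, mulVec_mulVec, nonsing_inv_mul B hB, one_mulVec, mulVec_neg] at e
    rw [mulVec_add, neg_add, ← e]
    abel
  have e1 : A *ᵥ (B⁻¹ *ᵥ (Aᵀ *ᵥ y')) = (A * B⁻¹ * Aᵀ) *ᵥ y' := by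
    rw [mulVec_mulVec, mulVec_mulVec]
  have e2 : (A * B⁻¹ * Aᵀ) *ᵥ y' = hv - A *ᵥ (B⁻¹ *ᵥ l) := by
    rw [← e1]
    rw [hd', mulVec_neg, mulVec_add, mulVec_add] at hbot
    exact eq_sub_of_add_eq' (neg_inj.mp hbot)
  have hy' : y' = newtonMultiplier B A l hv := by
    unfold newtonMultiplier
    rw [← e2, mulVec_mulVec, nonsing_inv_mul _ hQ, one_mulVec]
  refine ⟨hy', ?_⟩
  rw [newtonDir_eq, ← hy']
  exact hd'

omit [DecidableEq m] [DecidableEq n] in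
/-- (35): with `l = ∇f(x_k)ᵀ + Aᵀλ_k`, the top block `Bd + Aᵀy = −l` is the same as
`Bd + Aᵀλ_{k+1} = −∇f(x_k)ᵀ` with `λ_{k+1} = λ_k + y` ("the simple transformation used earlier").
[cite: LuenbergerYe2008, §14.4 (35)] -/
theorem shifted_top_iff (B : Matrix n n ℝ) (A : Matrix m n ℝ) (gradf d : n → ℝ) (lam y : m → ℝ) :
    B *ᵥ d + Aᵀ *ᵥ (lam + y) = -gradf ↔ B *ᵥ d + Aᵀ *ᵥ y = -(gradf + Aᵀ *ᵥ lam) := by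
  rw [mulVec_add]
  constructor
  · intro h
    rw [neg_add, ← h]
    abel
  · intro h
    rw [add_comm (Aᵀ *ᵥ lam), ← add_assoc, h]
    abel

/-- (38) with update (d): `λ̂ = (AB⁻¹Aᵀ)⁻¹[hv − AB⁻¹∇fᵀ]` is the multiplier `λ_{k+1}` of (35), and
the multiplier-update step `−B⁻¹∇l(x_k, λ̂)ᵀ = −B⁻¹[∇fᵀ + Aᵀλ̂]` is the structured Newton direction
("equivalent to the structured method"). [cite: LuenbergerYe2008, §14.4 (38), update (d)] -/
theorem update_d_structured (B : Matrix n n ℝ) (A : Matrix m n ℝ) (gradf : n → ℝ) (hv : m → ℝ) :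
    -(B⁻¹ *ᵥ (gradf + Aᵀ *ᵥ newtonMultiplier B A gradf hv)) = newtonDir B A gradf hv :=
  (newtonDir_eq B A gradf hv).symm

/-- Update (c): with `B = I` the multiplier of the structured method is
`(AAᵀ)⁻¹[hv − A∇fᵀ]`. [cite: LuenbergerYe2008, §14.4 update (c)] -/
theorem newtonMultiplier_one (A : Matrix m n ℝ) (gradf : n → ℝ) (hv : m → ℝ) :
    newtonMultiplier 1 A gradf hv = (A * Aᵀ)⁻¹ *ᵥ (hv - A *ᵥ gradf) := by
  simp [newtonMultiplier, inv_one]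

/-- Update (b), the least-squares multiplier `λ̂ = −(AAᵀ)⁻¹A∇fᵀ` (sign for the convention
`l = f + λᵀh`). [cite: LuenbergerYe2008, §14.4 update (b)] -/
noncomputable def lsMultiplier (A : Matrix m n ℝ) (gradf : n → ℝ) : m → ℝ :=
  -((A * Aᵀ)⁻¹ *ᵥ (A *ᵥ gradf))

omit [DecidableEq n] in
/-- With the least-squares multiplier, `∇l(x, λ̂)ᵀ = ∇fᵀ + Aᵀλ̂` lies in the tangent subspace:
`A[∇fᵀ + Aᵀλ̂] = 0` (for `AAᵀ` nonsingular, i.e. `A` of full row rank).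
[cite: LuenbergerYe2008, §14.4 update (b)] -/
theorem lsMultiplier_tangent {A : Matrix m n ℝ} (hA : IsUnit (A * Aᵀ).det) (gradf : n → ℝ) :
    A *ᵥ (gradf + Aᵀ *ᵥ lsMultiplier A gradf) = 0 := by
  unfold lsMultiplier
  rw [mulVec_neg, mulVec_add, mulVec_neg]
  simp only [mulVec_mulVec, ← Matrix.mul_assoc]
  rw [mul_nonsing_inv _ hA, Matrix.one_mul, add_neg_cancel]

/-- "This value of λ̂ makes `∇l(x_k, λ̂)ᵀ` equal to the projection of `∇f(x_k)ᵀ` onto the tangent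
plane": `∇fᵀ + Aᵀλ̂ = [I − Aᵀ(AAᵀ)⁻¹A]∇fᵀ`. [cite: LuenbergerYe2008, §14.4 update (b)] -/
theorem lsMultiplier_grad_eq_proj (A : Matrix m n ℝ) (gradf : n → ℝ) :
    gradf + Aᵀ *ᵥ lsMultiplier A gradf = (1 - Aᵀ * (A * Aᵀ)⁻¹ * A) *ᵥ gradf := by
  unfold lsMultiplier
  rw [sub_mulVec, one_mulVec, mulVec_neg, ← mulVec_mulVec, ← mulVec_mulVec, sub_eq_add_neg]

omit [DecidableEq n] in
/-- "This value also minimizes the merit function … with respect to λ": `λ̂` minimizes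
`|∇fᵀ + Aᵀλ|²` (Pythagoras: `∇fᵀ + Aᵀλ = [∇fᵀ + Aᵀλ̂] + Aᵀ(λ − λ̂)` with the first term tangent).
[cite: LuenbergerYe2008, §14.4 update (b)] -/
theorem lsMultiplier_isLeast {A : Matrix m n ℝ} (hA : IsUnit (A * Aᵀ).det) (gradf : n → ℝ)
    (lam : m → ℝ) :
    (gradf + Aᵀ *ᵥ lsMultiplier A gradf) ⬝ᵥ (gradf + Aᵀ *ᵥ lsMultiplier A gradf) ≤
      (gradf + Aᵀ *ᵥ lam) ⬝ᵥ (gradf + Aᵀ *ᵥ lam) := by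
  have htan := lsMultiplier_tangent hA gradf
  obtain ⟨r, hr⟩ : ∃ r, gradf + Aᵀ *ᵥ lsMultiplier A gradf = r := ⟨_, rfl⟩
  rw [hr] at htan ⊢
  have hdecomp : gradf + Aᵀ *ᵥ lam = r + Aᵀ *ᵥ (lam - lsMultiplier A gradf) := by
    rw [← hr, mulVec_sub]
    abel
  have horth : r ⬝ᵥ (Aᵀ *ᵥ (lam - lsMultiplier A gradf)) = 0 := by
    rw [mulVec_transpose, dotProduct_comm, ← dotProduct_mulVec, htan, dotProduct_zero]
  rw [hdecomp, add_dotProduct, dotProduct_add, dotProduct_add, horth,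
    dotProduct_comm (Aᵀ *ᵥ (lam - lsMultiplier A gradf)) r, horth]
  have h0 : 0 ≤ (Aᵀ *ᵥ (lam - lsMultiplier A gradf)) ⬝ᵥ (Aᵀ *ᵥ (lam - lsMultiplier A gradf)) :=
    Finset.sum_nonneg fun i _ => mul_self_nonneg _
  linarith

end Literature.Analysis.Convex.StructuredNewtonLagrange
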